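import Mathlib
import HarnessLib
import Summits.HubbardSuperconductivity.HubbardSuperconductivity.Theorems.KLProgrammeFermiSurfaceSharpTransversal

/-!
# Route `KLProgramme` (K1 `H10TwoPointLimit`, K3 `KLRegimeTwoPointLimit`) — risk-register item r2: the SHARP `BandBounds`
# bundle with Lean-certified NUMBERS on the DOPING WINDOW OF RECORD `μ ∈ [-0.4275, -0.1775]`

Cell `gate-hubbard-kl`, seat fs-1 (g6); companion of `KLProgrammeFermiSurfaceDopingWindow.lean` (why this window: it contains
margin-2's `μ`-window of record `[-0.42749, -0.1775]`, the certified image of `δ ∈ [0.10, 0.20]`). Numeric corollaries of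
`klfs_exists_sharpBandBounds` (`KLProgrammeFermiSurfaceSharpRange.lean`) at `a = -0.4275`, `b = -0.1775`, with the exact radial
transversality constant of `KLProgrammeFermiSurfaceSharpTransversal.lean`: the two transcendental inputs are
`d_a = arccos(0.106875) ≥ 1.46` (from `cos 1.46 = sin(π/2 - 1.46) > 0.1105`) and `K_b = arccos(-0.91125) ≤ 2.72` (from the
half-angle square of the quadratic cosine minorant, `cos x ≥ 2(1 - x²/8)² - 1 > 0.912` at `x = π - 2.72`); everything else is
rational arithmetic with `√2`, `√(-μ(4+μ))`, `√(32 - 2b²)`. Result (`klfs_dwin_sharpBandBounds`): a `BandBounds (-0.4275) (-0.1775)`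
with
  `umin ≥ 2.06`, `smax ≤ 3.85`, `A2 ≤ 33.2`, `hmin ≥ 0.188`, `amin ≥ 0.0648`, `rhomin ≥ 0.4118`, `cmax ≤ 0.685`,
  `Dtmin ≥ 0.8236` (`= 2 s_b`, exact), **`C_g ≤ 98`**, `Dcell ≤ 3.14`
(certified sharp values, kit j256230, two interval implementations, FS-WINDOW.md §8: `2.0700`, `3.8426`, `33.036`, `0.19196`,
`0.065016`, `0.41185`, `0.67928`, `0.82371`, `96.752`, `3.135`; the tree's generic bundle on the same range: `C_g = 54 442`,
`A2 = 925`, `smax = 18.2`, `Dcell = 10.8`). Also `∂ₜF ≥ 0.8236` at every level of the window (`klfs_dwin_rayDispersionDt_ge`).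
No definitions; everything PROVED. [folklore]
-/

noncomputable section

open Real Set

-- the tree's namespace `Summit.<Summit>.<Problem>.Theorems` repeats the summit name by design (D-0017)
set_option linter.dupNamespace false

namespace Summit.HubbardSuperconductivity.HubbardSuperconductivity.Theorems

open Literature.MathematicalPhysics.QuantumLattice
open Literature.MathematicalPhysics.QuantumLattice.BandSectorCounting

/-! ### §1 The numeric inputs -/

/-- **`d_a = arccos(0.106875) ≥ 1.46`** (`cos 1.46 = sin(π/2 - 1.46) > 0.1105 > 0.106875`). [folklore] -/
theorem klfs_numD_arccos_da_ge : (1.46 : ℝ) ≤ Real.arccos (-(-0.4275 : ℝ) / 4) := by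
  have hπ1 := Real.pi_gt_d6
  have hπ2 := Real.pi_lt_d6
  set x : ℝ := π / 2 - 1.46 with hx
  have hx1 : (0.110796 : ℝ) ≤ x := by rw [hx]; linarith
  have hx2 : x ≤ (0.110797 : ℝ) := by rw [hx]; linarith
  have hx0 : 0 < x := by linarith
  have hsin : x - x ^ 3 / 6 < Real.sin x := Real.sin_gt_sub_cube hx0
  have hx3 : x ^ 3 ≤ (0.110797 : ℝ) ^ 3 := pow_le_pow_left₀ hx0.le hx2 3
  have hcos : Real.cos 1.46 = Real.sin x := by rw [hx, Real.sin_pi_div_two_sub]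
  have hval : (-(-0.4275 : ℝ) / 4) ≤ Real.cos 1.46 := by rw [hcos]; norm_num at hx3 ⊢; linarith
  have h := Real.antitone_arccos hval
  rwa [Real.arccos_cos (by norm_num) (by linarith)] at h

/-- `d_a ≤ π/2 < 1.5708`. [folklore] -/
theorem klfs_numD_arccos_da_le : Real.arccos (-(-0.4275 : ℝ) / 4) ≤ 1.5708 := by
  have h := Real.arccos_lt_pi_div_two.2 (show (0 : ℝ) < -(-0.4275 : ℝ) / 4 by norm_num)
  have hπ2 := Real.pi_lt_d6
  linarith

/-- **`K_b = arccos(-0.91125) ≤ 2.72`** (`cos(π - 2.72) ≥ 2(1 - (π - 2.72)²/8)² - 1 > 0.912`, the half-angle square of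
the quadratic cosine minorant). [folklore] -/
theorem klfs_numD_umklappRadius_b_le : umklappRadius (-0.1775) ≤ 2.72 := by
  have hπ1 := Real.pi_gt_d6
  have hπ2 := Real.pi_lt_d6
  set x : ℝ := π - 2.72 with hx
  have hx1 : (0.421592 : ℝ) ≤ x := by rw [hx]; linarith
  have hx2 : x ≤ (0.421593 : ℝ) := by rw [hx]; linarith
  have hh : 1 - (x / 2) ^ 2 / 2 ≤ Real.cos (x / 2) := Real.one_sub_sq_div_two_le_cos
  have hh0 : 0 ≤ 1 - (x / 2) ^ 2 / 2 := by nlinarith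
  have hsq : (1 - (x / 2) ^ 2 / 2) ^ 2 ≤ Real.cos (x / 2) ^ 2 := pow_le_pow_left₀ hh0 hh 2
  have hdouble : Real.cos x = 2 * Real.cos (x / 2) ^ 2 - 1 := by
    have h := Real.cos_sq (x / 2)
    rw [show 2 * (x / 2) = x by ring] at h
    linarith
  have hx22 : x ^ 2 ≤ (0.421593 : ℝ) ^ 2 := pow_le_pow_left₀ (by linarith) hx2 2
  have hcx : (0.912 : ℝ) ≤ Real.cos x := by rw [hdouble]; nlinarith
  have hcos : Real.cos 2.72 = -Real.cos x := by
    rw [hx, Real.cos_pi_sub, neg_neg]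
  have hval : Real.cos 2.72 ≤ -(-0.1775 : ℝ) / 2 - 1 := by rw [hcos]; linarith
  have h := Real.antitone_arccos hval
  rw [Real.arccos_cos (by norm_num) (by linarith)] at h
  exact h

/-- `0.4118 ≤ s_* = min(s_a, s_b) ≤ s_b ≤ 0.4119` on the doping window (`s_μ = √(-μ(4+μ))/2`). [folklore] -/
theorem klfs_numD_levelSin_min :
    (0.4118 : ℝ) ≤ min (Real.sqrt (-(-0.4275 : ℝ) * (4 + -0.4275)) / 2) (Real.sqrt (-(-0.1775 : ℝ) * (4 + -0.1775)) / 2) ∧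
    min (Real.sqrt (-(-0.4275 : ℝ) * (4 + -0.4275)) / 2) (Real.sqrt (-(-0.1775 : ℝ) * (4 + -0.1775)) / 2) ≤ 0.4119 := by
  have ha : (0.617 : ℝ) ≤ Real.sqrt (-(-0.4275 : ℝ) * (4 + -0.4275)) / 2 := by
    rw [le_div_iff₀ (by norm_num : (0:ℝ) < 2), Real.le_sqrt (by norm_num) (by norm_num)]; norm_num
  have hb : (0.4118 : ℝ) ≤ Real.sqrt (-(-0.1775 : ℝ) * (4 + -0.1775)) / 2 := by
    rw [le_div_iff₀ (by norm_num : (0:ℝ) < 2), Real.le_sqrt (by norm_num) (by norm_num)]; norm_num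
  have hb' : Real.sqrt (-(-0.1775 : ℝ) * (4 + -0.1775)) / 2 ≤ 0.4119 := by
    rw [div_le_iff₀ (by norm_num : (0:ℝ) < 2), Real.sqrt_le_left (by norm_num)]; norm_num
  exact ⟨le_min (by linarith) hb, (min_le_right _ _).trans hb'⟩

/-- `0.0314 ≤ κ_b = 0.1775/√(32 - 2·0.1775²)`. [folklore] -/
theorem klfs_numD_kappa_b_ge : (0.0314 : ℝ) ≤ -(-0.1775 : ℝ) / Real.sqrt (32 - 2 * (-0.1775 : ℝ) ^ 2) := by
  have hs : Real.sqrt (32 - 2 * (-0.1775 : ℝ) ^ 2) ≤ 5.6513 := by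
    rw [Real.sqrt_le_left (by norm_num)]; norm_num
  have hs0 : 0 < Real.sqrt (32 - 2 * (-0.1775 : ℝ) ^ 2) := Real.sqrt_pos.2 (by norm_num)
  rw [le_div_iff₀ hs0]
  nlinarith

/-- `0.0885 ≤ min(n_a, n_b)` (`n_μ = (-μ/2)(1 - μ²/16)`; the minimum is `n_b = 0.08858`). [folklore] -/
theorem klfs_numD_levelN_min_ge :
    (0.0885 : ℝ) ≤ min (-(-0.4275 : ℝ) / 2 * (1 - (-0.4275 : ℝ) ^ 2 / 16)) (-(-0.1775 : ℝ) / 2 * (1 - (-0.1775 : ℝ) ^ 2 / 16)) :=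
  le_min (by norm_num) (by norm_num)

/-- `sin d_a / d_a ≤ 1/1.46 < 0.685`. [folklore] -/
theorem klfs_numD_sinc_da_le : Real.sin (Real.arccos (-(-0.4275 : ℝ) / 4)) / Real.arccos (-(-0.4275 : ℝ) / 4) ≤ 0.685 := by
  have hd := klfs_numD_arccos_da_ge
  have hd0 : 0 < Real.arccos (-(-0.4275 : ℝ) / 4) := by linarith
  rw [div_le_iff₀ hd0]
  have := Real.sin_le_one (Real.arccos (-(-0.4275 : ℝ) / 4))
  nlinarith

/-- `0 < sin d_a / d_a`. [folklore] -/
theorem klfs_numD_sinc_da_pos : 0 < Real.sin (Real.arccos (-(-0.4275 : ℝ) / 4)) / Real.arccos (-(-0.4275 : ℝ) / 4) := by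
  have hd := klfs_numD_arccos_da_ge
  have hdle := klfs_numD_arccos_da_le
  have hd0 : 0 < Real.arccos (-(-0.4275 : ℝ) / 4) := by linarith
  exact div_pos (Real.sin_pos_of_pos_of_lt_pi hd0 (by linarith [Real.pi_gt_d6])) hd0

/-! ### §2 Radial transversality and the bundle -/

/-- **`∂ₜF ≥ 0.8236` on the doping window** (`= 2 s_b`, exact radial transversality; `sin(√2 d_a) ≥ 0.585` and
`sin K_b = s_b ≥ 0.4118`). [folklore] -/
theorem klfs_dwin_rayDispersionDt_ge {μ : ℝ} (hμ : μ ∈ Icc (-0.4275 : ℝ) (-0.1775)) (θ : ℝ) :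
    (0.8236 : ℝ) ≤ rayDispersionDt θ (bandFermiRadius μ θ) := by
  have h := klfs_rayDispersionDt_ge_range (a := -0.4275) (b := -0.1775) (by norm_num) (by norm_num) (by norm_num) hμ θ
  have hs : (0.4118 : ℝ) ≤ Real.sin (umklappRadius (-0.1775)) := by
    rw [klfs_sin_umklappRadius (by norm_num) (by norm_num), le_div_iff₀ (by norm_num : (0:ℝ) < 2),
      Real.le_sqrt (by norm_num) (by norm_num)]
    norm_num
  have hp : (0.585 : ℝ) ≤ Real.sin (Real.sqrt 2 * Real.arccos (-(-0.4275 : ℝ) / 4)) :=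
    klfs_num_sin_sqrt_two_mul_ge (by linarith [klfs_numD_arccos_da_ge]) klfs_numD_arccos_da_le
  have hmin : (0.4118 : ℝ) ≤ min (Real.sin (Real.sqrt 2 * Real.arccos (-(-0.4275 : ℝ) / 4)))
      (Real.sin (umklappRadius (-0.1775))) := le_min (by linarith) hs
  linarith

/-- **The SHARP bundle on the doping window of record `μ ∈ [-0.4275, -0.1775]` with its constants as numbers and the
exact transversality constant**: a `BandBounds (-0.4275) (-0.1775)` with `umin ≥ 2.06`, `smax ≤ 3.85`, `A2 ≤ 33.2`,
`hmin ≥ 0.188`, `amin ≥ 0.0648`, `rhomin ≥ 0.4118`, `cmax ≤ 0.685`, `Dtmin ≥ 0.8236`, `C_g ≤ 98`, `Dcell ≤ 3.14`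
(certified sharp values, kit j256230: `2.0700, 3.8426, 33.036, 0.19196, 0.065016, 0.41185, 0.67928, 0.82371, 96.752,
3.135`; the tree's generic `bandBounds` on the same range: `umin = 1.89`, `smax = 18.2`, `A2 = 925`, `hmin = 0.0784`,
`amin = 3.7·10⁻⁴`, `rhomin = 0.2865`, `cmax = 1.058`, `Dtmin = 0.573`, `C_g = 54 442`, `Dcell = 10.84`). [folklore] -/
theorem klfs_dwin_sharpBandBounds :
    ∃ B : BandBounds (-0.4275) (-0.1775),
      2.06 ≤ B.umin ∧ B.smax ≤ 3.85 ∧ B.A2 ≤ 33.2 ∧ 0.188 ≤ B.hmin ∧ 0.0648 ≤ B.amin ∧ 0.4118 ≤ B.rhomin ∧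
      B.cmax ≤ 0.685 ∧ 0.8236 ≤ B.Dtmin ∧ B.Cg ≤ 98 ∧ B.Dcell ≤ 3.14 := by
  obtain ⟨B₀, hu, hs, hA, hh, ham, hr, hc, -⟩ :=
    klfs_exists_sharpBandBounds (a := -0.4275) (b := -0.1775) (by norm_num) (by norm_num) (by norm_num)
  obtain ⟨h2l, h2u⟩ := klfs_num_sqrt_two
  have hd := klfs_numD_arccos_da_ge
  have hK := klfs_numD_umklappRadius_b_le
  have hK0 : 0 < umklappRadius (-0.1775) := umklappRadius_pos (by norm_num)
  obtain ⟨hsl, hsu⟩ := klfs_numD_levelSin_min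
  have hκ := klfs_numD_kappa_b_ge
  have hn := klfs_numD_levelN_min_ge
  have hsinc := klfs_numD_sinc_da_le
  have hsinc0 := klfs_numD_sinc_da_pos
  -- the seven fields kept from the closed-form bundle
  have e_umin : 2.06 ≤ B₀.umin := by
    rw [hu]
    calc (2.06 : ℝ) ≤ 1.41421 * 1.46 := by norm_num
      _ ≤ Real.sqrt 2 * Real.arccos (-(-0.4275 : ℝ) / 4) := mul_le_mul h2l hd (by norm_num) (Real.sqrt_nonneg 2)
  have e_smax : B₀.smax ≤ 3.85 := by
    rw [hs]
    calc Real.sqrt 2 * umklappRadius (-0.1775) ≤ 1.41422 * 2.72 := mul_le_mul h2u hK hK0.le (by norm_num)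
      _ ≤ 3.85 := by norm_num
  have e_A2 : B₀.A2 ≤ 33.2 := by
    rw [hA]
    have h1 : umklappRadius (-0.1775) ^ 2 /
        min (Real.sqrt (-(-0.4275 : ℝ) * (4 + -0.4275)) / 2) (Real.sqrt (-(-0.1775 : ℝ) * (4 + -0.1775)) / 2) ≤
        2.72 ^ 2 / 0.4118 :=
      (div_le_div_of_nonneg_right (pow_le_pow_left₀ hK0.le hK 2) (by linarith)).trans
        (div_le_div_of_nonneg_left (by norm_num) (by norm_num) hsl)
    have h3 : 0 ≤ umklappRadius (-0.1775) ^ 2 /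
        min (Real.sqrt (-(-0.4275 : ℝ) * (4 + -0.4275)) / 2) (Real.sqrt (-(-0.1775 : ℝ) * (4 + -0.1775)) / 2) +
        2 * umklappRadius (-0.1775) := by positivity
    calc Real.sqrt 2 * (umklappRadius (-0.1775) ^ 2 /
          min (Real.sqrt (-(-0.4275 : ℝ) * (4 + -0.4275)) / 2) (Real.sqrt (-(-0.1775 : ℝ) * (4 + -0.1775)) / 2) +
          2 * umklappRadius (-0.1775))
        ≤ 1.41422 * (2.72 ^ 2 / 0.4118 + 2 * 2.72) := mul_le_mul h2u (by linarith) h3 (by norm_num)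
      _ ≤ 33.2 := by norm_num
  have e_hmin : 0.188 ≤ B₀.hmin := by
    rw [hh, le_div_iff₀ (pow_pos hsinc0 2)]
    have h1 : (Real.sin (Real.arccos (-(-0.4275 : ℝ) / 4)) / Real.arccos (-(-0.4275 : ℝ) / 4)) ^ 2 ≤ 0.685 ^ 2 :=
      pow_le_pow_left₀ hsinc0.le hsinc 2
    calc (0.188 : ℝ) * (Real.sin (Real.arccos (-(-0.4275 : ℝ) / 4)) / Real.arccos (-(-0.4275 : ℝ) / 4)) ^ 2
        ≤ 0.188 * 0.685 ^ 2 := mul_le_mul_of_nonneg_left h1 (by norm_num)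
      _ ≤ 0.0885 := by norm_num
      _ ≤ _ := hn
  have e_amin : 0.0648 ≤ B₀.amin := by
    rw [ham]
    calc (0.0648 : ℝ) ≤ 0.0314 * (1.41421 * 1.46) := by norm_num
      _ ≤ _ := mul_le_mul hκ (mul_le_mul h2l hd (by norm_num) (Real.sqrt_nonneg 2)) (by norm_num) (by linarith)
  have e_rhomin : 0.4118 ≤ B₀.rhomin := by rw [hr]; exact hsl
  have e_cmax : B₀.cmax ≤ 0.685 := by rw [hc]; exact hsinc
  -- the exact transversality constant replaces the closed-form `Dtmin`
  have hDt : ∀ μ ∈ Icc (-0.4275 : ℝ) (-0.1775), ∀ θ : ℝ, (0.8236 : ℝ) ≤ rayDispersionDt θ (bandFermiRadius μ θ) :=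
    fun μ hμ θ => klfs_dwin_rayDispersionDt_ge hμ θ
  refine ⟨{ B₀ with Dtmin := 0.8236, Dtmin_pos := by norm_num, Dt_ge := hDt }, e_umin, e_smax, e_A2, e_hmin, e_amin,
    e_rhomin, e_cmax, le_rfl, ?_, ?_⟩
  · show π * B₀.cmax / (2 * B₀.amin * B₀.rhomin ^ 2) ≤ 98
    have hπ := Real.pi_lt_d4
    have hBa : 0 < B₀.amin := B₀.amin_pos
    have hBr : 0 < B₀.rhomin := B₀.rhomin_pos
    rw [div_le_iff₀ (by positivity)]
    have h1 : π * B₀.cmax ≤ 3.1416 * 0.685 := mul_le_mul hπ.le e_cmax B₀.cmax_pos.le (by norm_num)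
    have h2 : (0.0648 : ℝ) * 0.4118 ^ 2 ≤ B₀.amin * B₀.rhomin ^ 2 :=
      mul_le_mul e_amin (pow_le_pow_left₀ (by norm_num) e_rhomin 2) (by norm_num) hBa.le
    have h3 : 98 * (2 * B₀.amin * B₀.rhomin ^ 2) = 196 * (B₀.amin * B₀.rhomin ^ 2) := by ring
    rw [h3]
    linarith
  · show 1 / (0.8236 : ℝ) + B₀.smax / 2 ≤ 3.14
    have : (1 : ℝ) / 0.8236 ≤ 1.2142 := by norm_num
    linarith

end Summit.HubbardSuperconductivity.HubbardSuperconductivity.Theorems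

end
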